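import Summits.QuantumFields.BalabanUV.T4Continuum.Spine.NE1p.DressedRootSameLattice

/-!
# T⁴ programme, spine estimate NE1′ (node O3b/H2) — THE (I4′) SOCKET OF THE SAME-LATTICE FACE FIRES ON `ℤ²`, PART 1: THE LATTICE DATUM
# (decided toy) — a `U(1)` plaquette functional on `ℤ²`, its exact block-gauge invariance, its birth slice at every `U(1)`-valued base,
# bump configurations and their based-plaquette deviations, and the toy booking∕trajectory∕tower it feeds

Cell `pub-balaban`, sub-cell `t4`, BINDER-OWNERS row NE1′, NE1′ formalisation crew `b2b-balaban-t4-ne1p-formalise-*`, seat `…-leaf-06`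
(gen 5; lineage S7b `DressedTransportCrude` p213050, S7c `DressedPartnerRegularity` p213364, S8 `DressedAttainment` p212678, W4s
`DressedRootStrictSeparation` p217657).  ADDITIVE — imports the owner's N0f `Spine/NE1p/DressedRootSameLattice` (p218843) ONLY; modifies
nothing; no witness row is imported or copied.  Part 2 (`…WitnessEnd`) discharges N0f §3's `hpair` on this datum and fires ROOT-C of record
THROUGH `hlin_of_twoSidedRegularity` + `hdefw_of_window` BY NAME.  SIBLING of the owner's N0h `DressedRootSameLatticeWitness` (p219111:
the face on the complex LINE, `rel = Eq`, no lattice); THIS pair of files decides N0f **§3**, the (I4′) socket, on the LATTICE `ℤ²` with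
`R = ℂ` — binders no landed file applies (S3v p219142 CARRIES `hnorm`∕`hpair` as displayed binders; `T4BlockTransport` §8's lattice toy
is the ZERO functional).  Typer R-T80 (vi): «ONE more witness through S3v or N0f §3 directly is admissible on the file-and-line standard».

THE DATUM [decided toy; nothing of Bałaban's is modelled].  Block side `Lg = 2` at the corner `0 ∈ ℤ²` (the block `B(0) = {0,1}²` has ONE
based square); booking block size `L = 2` (`ψ = (2²)⁻¹`, `τ = 2⁻³`, `Λ = 2⁴`).
* §1 `expUnit x = e^{ix} ∈ ℂˣ` (inverse `e^{−ix}`; `UnitaryLike`; `‖e^{±ix} − 1‖ ≤ |x|`, `‖e^{ix} − e^{−ix}‖ = 2 sin x`); `bump u : Cfg 2 ℂ` =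
  `u` on the bond `⟨e₀, e₀+e₁⟩`, `1` elsewhere; a based square with corners in `{0,1}²` is based at `0` (`eq_zero_of_inBlock_two`), where
  the bump's plaquettes are `u`, `u⁻¹`; hence `plaqSup_bump : ‖u − 1‖ ≤ q ∧ ‖u⁻¹ − 1‖ ≤ q → PlaqSup 2 0 ‖plaq (bump u) − 1‖ q` — the
  `PlaqSup` SHAPE of the (I4′) socket, inhabited by curved data.
* §2 THE CARRIED FUNCTION = the `U(1)` PLAQUETTE FUNCTIONAL with FIELD inverses, `plaqFn V = V(0;e₀)·V(e₀;e₁)·V(e₁;e₀)⁻¹·V(0;e₁)⁻¹` on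
  `Fld 2 ℂ`, coefficient `(1/8)^K` for the birth generation (`twFn K 0`; later generations carry `0`): EXACTLY `BlockRel 2 0`-invariant
  (`plaqFn_blockRel`: the gauge cancels around the square, whose four bonds are interior to `B(0)`), NON-CONSTANT (`plaqFn_nonconst`), with a `BirthSlice` along the affine
  lattice chart `latMove`∕`latN` at EVERY base in the regular set `𝒦tw` = the `U(1)`-valued bond fields, window `w = 1/8`, radius
  `r = 1/16`, sup `twGen K 0 = 3·(1/8)^K` (`twFn_birthSlice`: on `ball 0 (1 + (1/8)/latN D)` ⊇ the discs of radius `(1/16)/latN D` about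
  `[0,1]` every moved bond value lies in the annulus `3/4 ≤ |·| ≤ 5/4`, so the inverted factors are holomorphic and `|plaqFn| ≤ 25/9 ≤ 3`).
* §3 `twBooking`∕`twTrajectory`∕`twTower` (the shape of N0h's `slBooking`: one family per cutoff born at scale `0`, one cube per scale, ONE
  generation of size `twGen`): booked size `twSize K k = (1/8)^K·2 sin φ_k`, `φ_k = (1/16)·((2²)⁻¹)^k`, POSITIVE (`twSize_pos`) — by Part 2
  EXACTLY the response of `twFn K 0` to a two-sided curved unitary-like pair.

HONEST FRAMING (c3∕c4∕c6; t4-ref2 (m3)∕(m7)).  A decided `U(1)` lattice toy on ONE plaquette: it inhabits the SHAPES `UnitaryLike`∕`PlaqSup`∕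
`BlockRel`∕`BirthSlice` of the (I4′) socket and says NOTHING about Bałaban's minimisers or backgrounds, the cell's D-terms, or `SU(2)`;
(I4′) for the cell's pairs remains a HYPOTHESIS of printed TYPE; `ψ = L⁻²` is the cell's rate, not print.  The `def`s below are toy DATA
(no `def … : Prop`); 0 sorry; 0 citations.  Headline (c4): «the (I4′) socket fires on one decided lattice datum», never «NE1′ proved»;
wall v1.4 of record, v1.5 met (Q42 (b1)+(b2)), T4-DAG rewording owed.  NE1′ NOT printed, NOT proved; spine PROVED 0∕9.  Rung (B)+1
on ONE finite four-torus — NOT infinite volume, NOT a mass gap, NOT OS on ℝ⁴, NOT Clay.  HONEST DEPENDENCY: continuum YM on T⁴ ⇐ BetaPertH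
∧ nine spine estimates (0/9 proved); BetaPertH ⇐ (D1) ∧ (D4) ∧ CAP+tail; G-an2-4 gates asym, D1 and NE2/3/4.
-/

noncomputable section

namespace Summit.QuantumFields.BalabanUV.T4Continuum.NE1p.DressedTwoSidedRegularityWitness

open Finset Metric Set Complex
open scoped BigOperators
open Literature.MathematicalPhysics.QuantumFieldTheory.Balaban1983to89
open Literature.MathematicalPhysics.QuantumFieldTheory.Balaban1983to89.T4TermFormat
open Literature.MathematicalPhysics.QuantumFieldTheory.Balaban1983to89.T4TrajectoryComparison
open Literature.MathematicalPhysics.QuantumFieldTheory.Balaban1983to89.T4BirthChartTransport (GaugeInvariant BirthSlice)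
open Literature.MathematicalPhysics.QuantumFieldTheory.Balaban1983to89.B8Lemma1Lattice (e InBlock)
open Literature.MathematicalPhysics.QuantumFieldTheory.Balaban1983to89.T4RelativeLadder (UnitaryLike)
open Literature.MathematicalPhysics.QuantumFieldTheory.Balaban1983to89.T4RelativeComb (Cfg plaq PlaqSup)
open Literature.MathematicalPhysics.QuantumFieldTheory.Balaban1983to89.T4BlockTransport
  (Fld val val_apply NDir latMove latN norm_dir_le BlockRel)
open Summit.QuantumFields.BalabanUV.T4Continuum.T4TrajectoryDensityDressed
open Summit.QuantumFields.BalabanUV.T4Continuum.NE1p.DressedRoot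
open Summit.QuantumFields.BalabanUV.T4Continuum.NE1p.DressedUniformConstants
open Summit.QuantumFields.BalabanUV.T4Continuum.NE1p.DressedRootSameLattice

/-! ## §1 Unit-circle units and bump configurations on `ℤ²` -/

/-- The unit `e^{ix} ∈ ℂˣ` with inverse `e^{−ix}`. [decided toy] -/
def expUnit (x : ℝ) : ℂˣ where
  val := exp (I * x)
  inv := exp (I * ((-x : ℝ) : ℂ))
  val_inv := by
    rw [← Complex.exp_add]
    have h : I * (x : ℂ) + I * ((-x : ℝ) : ℂ) = 0 := by push_cast; ring
    rw [h, Complex.exp_zero]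
  inv_val := by
    rw [← Complex.exp_add]
    have h : I * ((-x : ℝ) : ℂ) + I * (x : ℂ) = 0 := by push_cast; ring
    rw [h, Complex.exp_zero]

/-- Its value `e^{ix}`. [decided toy] -/
@[simp] theorem expUnit_val (x : ℝ) : ((expUnit x : ℂˣ) : ℂ) = exp (I * x) := rfl

/-- Its inverse's value `e^{−ix}`. [decided toy] -/
@[simp] theorem expUnit_inv_val (x : ℝ) : (((expUnit x)⁻¹ : ℂˣ) : ℂ) = exp (I * ((-x : ℝ) : ℂ)) := rfl

/-- `‖e^{ix}‖ = 1`. [folklore] -/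
theorem norm_exp_I_mul (x : ℝ) : ‖exp (I * x)‖ = 1 := by
  rw [mul_comm]; exact Complex.norm_exp_ofReal_mul_I x

/-- `e^{ix}` is unitary-like. [folklore] -/
theorem unitaryLike_expUnit (x : ℝ) : UnitaryLike (expUnit x) :=
  ⟨(norm_exp_I_mul x).le, (norm_exp_I_mul (-x)).le⟩

/-- `‖e^{ix} − 1‖ ≤ |x|` and `‖(e^{ix})⁻¹ − 1‖ ≤ |x|` (Mathlib `Real.norm_exp_I_mul_ofReal_sub_one_le`). [folklore] -/
theorem norm_expUnit_sub_one_le (x : ℝ) :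
    ‖((expUnit x : ℂˣ) : ℂ) - 1‖ ≤ |x| ∧ ‖(((expUnit x)⁻¹ : ℂˣ) : ℂ) - 1‖ ≤ |x| := by
  refine ⟨?_, ?_⟩
  · rw [expUnit_val, ← Real.norm_eq_abs]; exact Real.norm_exp_I_mul_ofReal_sub_one_le
  · rw [expUnit_inv_val, ← abs_neg, ← Real.norm_eq_abs]; exact Real.norm_exp_I_mul_ofReal_sub_one_le

/-- `‖e^{ix} − e^{−ix}‖ = 2·sin x` for `0 ≤ x ≤ π` (factor `e^{−ix}` out; `‖e^{2ix} − 1‖ = |2 sin x|`). [folklore] -/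
theorem norm_exp_sub_exp_neg {x : ℝ} (hx0 : 0 ≤ x) (hxπ : x ≤ Real.pi) :
    ‖exp (I * x) - exp (I * ((-x : ℝ) : ℂ))‖ = 2 * Real.sin x := by
  have hfac : exp (I * x) - exp (I * ((-x : ℝ) : ℂ)) = exp (I * ((-x : ℝ) : ℂ)) * (exp (I * ((2 * x : ℝ) : ℂ)) - 1) := by
    rw [mul_sub, mul_one, ← Complex.exp_add]
    congr 1
    push_cast; ring_nf
  rw [hfac, norm_mul, norm_exp_I_mul, one_mul, Complex.norm_exp_I_mul_ofReal_sub_one]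
  have h2 : (2 * x) / 2 = x := by ring
  rw [h2, Real.norm_of_nonneg (mul_nonneg zero_le_two (Real.sin_nonneg_of_nonneg_of_le_pi hx0 hxπ))]

/-- THE BUMP CONFIGURATION [decided toy]: `u` on the bond `⟨e₀, e₀ + e₁⟩` (site `(1,0)`, direction `1`), `1` on every other bond of `ℤ²`. -/
def bump (u : ℂˣ) : Cfg 2 ℂ := fun x ν => if x 0 = 1 ∧ x 1 = 0 ∧ ν = 1 then u else 1

/-- A bump of a unitary-like unit is a unitary-like configuration. [decided toy] -/
theorem unitaryLike_bump {u : ℂˣ} (hu : UnitaryLike u) (x : Fin 2 → ℤ) (ν : Fin 2) : UnitaryLike (bump u x ν) := by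
  unfold bump; split_ifs
  · exact hu
  · exact T4RelativeLadder.UnitaryLike.one

/-- The based squares `(0; e₀, e₁)` and `(0; e₁, e₀)` of a bump have plaquette variables `u` and `u⁻¹`. [decided toy] -/
theorem plaq_bump_zero (u : ℂˣ) : plaq (bump u) 0 0 1 = u ∧ plaq (bump u) 0 1 0 = u⁻¹ := by
  constructor <;> simp [T4RelativeComb.plaq, bump, e]

/-- In `ℤ²`, a based square `(y; ρ, ν)`, `ρ ≠ ν`, whose base and far corner lie in the block `B(0) = {0,1}²` is based at `y = 0`. [folklore] -/
theorem eq_zero_of_inBlock_two {y : Fin 2 → ℤ} {ρ ν : Fin 2} (hρν : ρ ≠ ν) (h0 : InBlock 2 0 y)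
    (h3 : InBlock 2 0 (y + e ρ + e ν)) : y = 0 := by
  funext κ
  have a := (h0 κ).1
  have b := (h3 κ).2
  fin_cases ρ <;> fin_cases ν
  · exact absurd rfl hρν
  · fin_cases κ <;> simp [e] at a b ⊢ <;> omega
  · fin_cases κ <;> simp [e] at a b ⊢ <;> omega
  · exact absurd rfl hρν

/-- **EVERY BASED PLAQUETTE OF `B(0)` OF A BUMP IS WITHIN `q` OF `1`** once `‖u − 1‖ ≤ q` and `‖u⁻¹ − 1‖ ≤ q` — the `PlaqSup` shape of the
(I4′) socket, inhabited. [decided toy] -/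
theorem plaqSup_bump {u : ℂˣ} {q : ℝ} (h : ‖(u : ℂ) - 1‖ ≤ q ∧ ‖((u⁻¹ : ℂˣ) : ℂ) - 1‖ ≤ q) :
    PlaqSup 2 0 (fun y ρ ν => ‖(plaq (bump u) y ρ ν : ℂ) - 1‖) q := by
  intro y ρ ν hρν hy _ _ hy3
  obtain rfl := eq_zero_of_inBlock_two hρν hy hy3
  fin_cases ρ <;> fin_cases ν
  · exact absurd rfl hρν
  · show ‖((plaq (bump u) 0 0 1 : ℂˣ) : ℂ) - 1‖ ≤ q
    rw [(plaq_bump_zero u).1]; exact h.1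
  · show ‖((plaq (bump u) 0 1 0 : ℂˣ) : ℂ) - 1‖ ≤ q
    rw [(plaq_bump_zero u).2]; exact h.2
  · exact absurd rfl hρν

/-! ## §2 The carried function: the `U(1)` plaquette functional on `ℂ`-valued bond fields — invariance and birth slice -/

/-- THE PLAQUETTE FUNCTIONAL with field inverses: `V(0;e₀)·V(e₀;e₁)·V(e₁;e₀)⁻¹·V(0;e₁)⁻¹` on `Fld 2 ℂ = (ℤ² → Fin 2 → ℂ)`.
[decided toy] -/
def plaqFn (V : Fld 2 ℂ) : ℂ := V 0 0 * V (e 0) 1 * (V (e 1) 0)⁻¹ * (V 0 1)⁻¹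

/-- The coefficient of the birth generation at cutoff `K`: `(1/8)^K` (source decay `τ^K` to the unit lattice). [decided toy] -/
def coef (K : ℕ) : ℝ := (1 / 8 : ℝ) ^ K

/-- The coefficient is positive. [arith] -/
theorem coef_pos (K : ℕ) : 0 < coef K := by unfold coef; positivity

/-- THE CARRIED FUNCTION of generation `k′` at cutoff `K`: `(1/8)^K · plaqFn` for the birth generation `k′ = 0`, `0` later. [decided toy] -/
def twFn (K : ℕ) : ℕ → Fld 2 ℂ → ℂ
  | 0 => fun V => (coef K : ℂ) * plaqFn V
  | _ + 1 => fun _ => 0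

/-- GENERATION SIZES: `3·(1/8)^K` for the birth generation (the slice sup below), `0` later. [decided toy] -/
def twGen (K : ℕ) : ℕ → ℝ
  | 0 => 3 * coef K
  | _ + 1 => 0

/-- On unit-valued configurations the functional IS the based plaquette `(0; e₀, e₁)`; on a bump it is `u`. [decided toy] -/
theorem plaqFn_val (U : Cfg 2 ℂ) : plaqFn (val U) = ((plaq U 0 0 1 : ℂˣ) : ℂ) := by
  simp only [plaqFn, val_apply, T4RelativeComb.plaq, Units.val_mul, Units.val_inv_eq_inv_val, zero_add]

/-- … in particular on a bump it is `u`. [decided toy] -/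
theorem plaqFn_val_bump (u : ℂˣ) : plaqFn (val (bump u)) = (u : ℂ) := by
  rw [plaqFn_val, (plaq_bump_zero u).1]

/-- The plaquette functional is NON-CONSTANT on `U(1)`-valued configurations: the bump `e^{iπ}` (plaquette `−1`) and the flat configuration
(plaquette `1`) are separated. [decided toy] -/
theorem plaqFn_nonconst : plaqFn (val (bump (expUnit Real.pi))) ≠ plaqFn (val 1) := by
  rw [plaqFn_val_bump, plaqFn_val, expUnit_val]
  have hpi : exp (I * (Real.pi : ℂ)) = -1 := by rw [mul_comm]; exact Complex.exp_pi_mul_I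
  have h1 : ((plaq (1 : Cfg 2 ℂ) 0 0 1 : ℂˣ) : ℂ) = 1 := by simp [T4RelativeComb.plaq]
  rw [hpi, h1]
  norm_num

/-- The corners `0`, `e_ν`, `e₀ + e₁` of the square lie in the block `B(0)` of side `2`. [folklore] -/
theorem inBlock_two : InBlock 2 (0 : Fin 2 → ℤ) 0 ∧ (∀ ν : Fin 2, InBlock 2 (0 : Fin 2 → ℤ) (e ν)) ∧
    InBlock 2 (0 : Fin 2 → ℤ) (e 0 + e 1) := by
  refine ⟨fun κ => ?_, fun ν κ => ?_, fun κ => ?_⟩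
  · fin_cases κ <;> simp
  · fin_cases ν <;> fin_cases κ <;> simp [e]
  · fin_cases κ <;> simp [e]

/-- **EXACT BLOCK-GAUGE INVARIANCE** [decided toy]: for `V = g·U·g⁻¹` on the interior bonds of `B(0)`, `g : ℤ² → ℂˣ`, the gauge factors
CANCEL around the square (all four of its bonds are interior): `plaqFn U = plaqFn V`. -/
theorem plaqFn_blockRel {U V : Fld 2 ℂ} (h : BlockRel 2 0 U V) : plaqFn U = plaqFn V := by
  obtain ⟨g, -, hV⟩ := h
  obtain ⟨hz, he, hee⟩ := inBlock_two
  have h1 := hV 0 0 hz (by simpa using he 0)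
  have h2 := hV (e 0) 1 (he 0) hee
  have h3 := hV (e 1) 0 (he 1) (by rw [add_comm]; exact hee)
  have h4 := hV 0 1 hz (by simpa using he 1)
  simp only [zero_add] at h1 h4
  rw [add_comm] at h3
  unfold plaqFn
  rw [h1, h2, h3, h4]
  simp only [Units.val_inv_eq_inv_val]
  have g0 : ((g 0 : ℂˣ) : ℂ) ≠ 0 := (g 0).ne_zero
  have g1 : ((g (e 0) : ℂˣ) : ℂ) ≠ 0 := (g (e 0)).ne_zero
  have g2 : ((g (e 1) : ℂˣ) : ℂ) ≠ 0 := (g (e 1)).ne_zero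
  have g3 : ((g (e 0 + e 1) : ℂˣ) : ℂ) ≠ 0 := (g (e 0 + e 1)).ne_zero
  by_cases hu3 : U (e 1) 0 = 0
  · simp [hu3]
  by_cases hu4 : U 0 1 = 0
  · simp [hu4]
  field_simp

/-- Gauge invariance of every carried function under `BlockRel 2 0`. [decided toy] -/
theorem twFn_gaugeInvariant (K k' : ℕ) : GaugeInvariant (BlockRel 2 0) (twFn K k') := by
  intro U V h
  cases k' with
  | zero => show (coef K : ℂ) * plaqFn U = (coef K : ℂ) * plaqFn V; rw [plaqFn_blockRel h]
  | succ n => rfl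

/-- THE REGULAR SET [decided toy]: `U(1)`-valued bond fields (every bond variable on the unit circle). -/
def 𝒦tw : Set (Fld 2 ℂ) := {V | ∀ x ν, ‖V x ν‖ = 1}

/-- Unitary-like configurations (in `ℂ`: `‖u‖ ≤ 1`, `‖u⁻¹‖ ≤ 1`, hence `‖u‖ = 1`) take values in the regular set. [folklore] -/
theorem val_mem_𝒦tw {U : Cfg 2 ℂ} (hU : ∀ x ν, UnitaryLike (U x ν)) : val U ∈ 𝒦tw := by
  intro x ν
  rw [val_apply]
  refine le_antisymm (hU x ν).1 ?_
  have hprod : ‖(U x ν : ℂ)‖ * ‖(((U x ν)⁻¹ : ℂˣ) : ℂ)‖ = 1 := by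
    rw [← norm_mul, ← Units.val_mul, mul_inv_cancel, Units.val_one, norm_one]
  calc (1 : ℝ) = ‖(U x ν : ℂ)‖ * ‖(((U x ν)⁻¹ : ℂˣ) : ℂ)‖ := hprod.symm
    _ ≤ ‖(U x ν : ℂ)‖ * 1 := mul_le_mul_of_nonneg_left (hU x ν).2 (norm_nonneg _)
    _ = ‖(U x ν : ℂ)‖ := mul_one _

/-- THE WINDOW ESTIMATE [arith]: a bond value of norm `1` moved by at most `1/4` stays in the annulus `3/4 ≤ |·| ≤ 5/4`. -/
theorem annulus {a b : ℂ} (ha : ‖a‖ = 1) (hb : ‖b‖ ≤ 1 / 4) : 3 / 4 ≤ ‖a + b‖ ∧ ‖a + b‖ ≤ 5 / 4 := by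
  have h1 := norm_sub_le (a + b) b
  have h2 := norm_add_le a b
  rw [add_sub_cancel_right, ha] at h1
  rw [ha] at h2
  constructor <;> linarith

/-- **THE BIRTH SLICE OF THE PLAQUETTE FUNCTIONAL** [decided toy]: at EVERY base `V ∈ 𝒦tw` and every lattice direction `D` with declared sup
bound `0 < latN D ≤ 1/8`, the slice `t ↦ twFn K k′ (V + t·D)` is holomorphic and bounded by the generation size `twGen K k′` on
`ball 0 (1 + (1/8)/latN D)` ⊇ the closed discs of radius `(1/16)/latN D` about `[0,1]`: there every moved bond value lies in the annulus
`3/4 ≤ |·| ≤ 5/4`, so the two inverted factors do not vanish and `|plaqFn| ≤ (5/4)²·(4/3)² = 25/9 ≤ 3`. -/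
theorem twFn_birthSlice (K k' : ℕ) : BirthSlice (twFn K k') latMove latN 𝒦tw (1 / 8) (1 / 16) (twGen K k') := by
  intro V hV D hs hsw
  set s := latN D with hs_def
  have hsmall : ∀ t ∈ ball (0 : ℂ) ((s + 1 / 8) / s), ∀ x ν, ‖t * D.1.1 x ν‖ ≤ 1 / 4 := by
    intro t ht x ν
    rw [mem_ball, dist_zero_right, lt_div_iff₀ hs] at ht
    rw [norm_mul]
    calc ‖t‖ * ‖D.1.1 x ν‖ ≤ ‖t‖ * s := mul_le_mul_of_nonneg_left (norm_dir_le D x ν) (norm_nonneg _)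
      _ ≤ 1 / 4 := by linarith
  have hann : ∀ t ∈ ball (0 : ℂ) ((s + 1 / 8) / s), ∀ x ν,
      3 / 4 ≤ ‖V x ν + t * D.1.1 x ν‖ ∧ ‖V x ν + t * D.1.1 x ν‖ ≤ 5 / 4 :=
    fun t ht x ν => annulus (hV x ν) (hsmall t ht x ν)
  have hne : ∀ x ν, ∀ t ∈ ball (0 : ℂ) ((s + 1 / 8) / s), V x ν + t * D.1.1 x ν ≠ 0 := by
    intro x ν t ht h0
    have h := (hann t ht x ν).1
    rw [h0, norm_zero] at h
    linarith
  refine ⟨ball (0 : ℂ) ((s + 1 / 8) / s), ?_, ?_, ?_⟩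
  · -- holomorphy of the slice
    cases k' with
    | succ n => exact differentiableOn_const _
    | zero =>
      have hd : ∀ x ν, DifferentiableOn ℂ (fun t : ℂ => V x ν + t * D.1.1 x ν) (ball (0 : ℂ) ((s + 1 / 8) / s)) :=
        fun x ν => by fun_prop
      have hP : DifferentiableOn ℂ (fun t : ℂ => (coef K : ℂ) * ((V 0 0 + t * D.1.1 0 0) * (V (e 0) 1 + t * D.1.1 (e 0) 1)
          * (V (e 1) 0 + t * D.1.1 (e 1) 0)⁻¹ * (V 0 1 + t * D.1.1 0 1)⁻¹)) (ball (0 : ℂ) ((s + 1 / 8) / s)) :=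
        ((((hd 0 0).mul (hd (e 0) 1)).mul ((hd (e 1) 0).inv (hne (e 1) 0))).mul ((hd 0 1).inv (hne 0 1))).const_mul _
      exact hP
  · -- the bound by the generation size
    intro t ht
    cases k' with
    | succ n => simp [twFn, twGen]
    | zero =>
      have hinv : ∀ x ν, ‖(V x ν + t * D.1.1 x ν)⁻¹‖ ≤ 4 / 3 := by
        intro x ν
        rw [norm_inv]
        calc ‖V x ν + t * D.1.1 x ν‖⁻¹ ≤ (3 / 4 : ℝ)⁻¹ := inv_anti₀ (by norm_num) (hann t ht x ν).1
          _ = 4 / 3 := by norm_num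
      show ‖(coef K : ℂ) * ((V 0 0 + t * D.1.1 0 0) * (V (e 0) 1 + t * D.1.1 (e 0) 1)
          * (V (e 1) 0 + t * D.1.1 (e 1) 0)⁻¹ * (V 0 1 + t * D.1.1 0 1)⁻¹)‖ ≤ 3 * coef K
      rw [norm_mul, Complex.norm_real, Real.norm_of_nonneg (coef_pos K).le, norm_mul, norm_mul, norm_mul, mul_comm]
      refine mul_le_mul_of_nonneg_right ?_ (coef_pos K).le
      calc ‖V 0 0 + t * D.1.1 0 0‖ * ‖V (e 0) 1 + t * D.1.1 (e 0) 1‖ * ‖(V (e 1) 0 + t * D.1.1 (e 1) 0)⁻¹‖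
            * ‖(V 0 1 + t * D.1.1 0 1)⁻¹‖ ≤ (5 / 4) * (5 / 4) * (4 / 3) * (4 / 3) := by
            gcongr
            · exact (hann t ht 0 0).2
            · exact (hann t ht (e 0) 1).2
            · exact hinv (e 1) 0
            · exact hinv 0 1
        _ ≤ 3 := by norm_num
  · -- the closed discs about `[0,1]`
    intro σ hσ z hz
    rw [mem_closedBall] at hz
    rw [mem_ball, dist_zero_right]
    have hσ1 : ‖(σ : ℂ)‖ ≤ 1 := by
      rw [Complex.norm_real, Real.norm_eq_abs, abs_of_nonneg hσ.1]; exact hσ.2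
    have hlt : (1 / 16 : ℝ) / s < (1 / 8) / s := div_lt_div_of_pos_right (by norm_num) hs
    have heq : (s + 1 / 8) / s = 1 + (1 / 8) / s := by rw [add_div, div_self hs.ne']
    calc ‖z‖ = ‖(z - σ) + σ‖ := by rw [sub_add_cancel]
      _ ≤ ‖z - (σ : ℂ)‖ + ‖(σ : ℂ)‖ := norm_add_le _ _
      _ ≤ (1 / 16) / s + 1 := add_le_add (by rwa [← dist_eq_norm]) hσ1
      _ < (s + 1 / 8) / s := by rw [heq]; linarith

/-! ## §3 The booking, trajectory and tower: one family per cutoff, booked size = the lattice response -/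

/-- THE PLAQUETTE ANGLE at scale `k`: `φ_k = (1/16)·((2²)⁻¹)^k` (per-side allowance `aᵢ = 1/16`, rate `ψ = (2²)⁻¹`). [decided toy] -/
def φ (k : ℕ) : ℝ := (1 / 16 : ℝ) * (((2 : ℝ) ^ 2)⁻¹) ^ k

/-- The angles are positive … [arith] -/
theorem φ_pos (k : ℕ) : 0 < φ k := by unfold φ; positivity

/-- … and below `π` (indeed `≤ 1/16`). [arith] -/
theorem φ_lt_pi (k : ℕ) : φ k < Real.pi := by
  have h : (((2 : ℝ) ^ 2)⁻¹) ^ k ≤ 1 := pow_le_one₀ (by norm_num) (by norm_num)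
  have h16 : φ k ≤ 1 / 16 := by unfold φ; nlinarith
  have := Real.pi_gt_three
  linarith

/-- THE BOOKED SIZE at scale `k` of cutoff `K`: `(1/8)^K · 2 sin φ_k` (§4: EXACTLY the response to the scale-`k` attaining pair). [decided toy] -/
def twSize (K k : ℕ) : ℝ := coef K * (2 * Real.sin (φ k))

/-- Booked sizes are POSITIVE. [decided toy] -/
theorem twSize_pos (K k : ℕ) : 0 < twSize K k :=
  mul_pos (coef_pos K) (mul_pos two_pos (Real.sin_pos_of_pos_of_lt_pi (φ_pos k) (φ_lt_pi k)))

/-- TOY BOOKING at cutoff `K` [decided toy; the shape of N0h's `slBooking`]: one family born at scale `0`, one cube per scale, size `twSize K k`. -/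
def twBooking (K : ℕ) : T4TermFormat.Booking where
  K := K
  Dom := Unit
  domScale := fun _ => 0
  treeLen := fun _ => 0
  treeLen_nonneg := fun _ => le_rfl
  balSize := fun _ => 0
  Birth := Unit
  births := {()}
  mem_births := fun b => by simp
  birthScale := fun _ => 0
  birth_le := fun _ => Nat.zero_le K
  loc := fun _ => ()
  loc_scale := fun _ => rfl
  Cube := Fin (K + 1)
  cubes := Finset.univ
  mem_cubes := fun q => Finset.mem_univ q
  cubeScale := fun q => q.val
  cube_le := fun q => Nat.lt_succ_iff.mp q.isLt
  feltAt := fun _ => {()}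
  felt_birth_le := fun _ _ _ => Nat.zero_le _
  size := fun _ k => twSize K k
  size_nonneg := fun _ k => (twSize_pos K k).le
  pair := fun _ _ _ => 0

/-- Booked size of generation `k′` at scale `k`: the birth generation books `twSize K k`, later generations `0`. [decided toy] -/
def twLin (K : ℕ) : ℕ → ℕ → ℝ
  | 0 => fun k => twSize K k
  | _ + 1 => fun _ => 0

/-- TOY TRAJECTORY [decided toy]: ONE generation; re-linearised size = the booked size. -/
def twTrajectory (K : ℕ) : Trajectory (twBooking K) where
  lin := fun _ k' k => twLin K k' k
  lin_nonneg := fun _ k' k => by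
    cases k' with
    | zero => exact (twSize_pos K k).le
    | succ n => exact le_rfl
  gen := fun _ k' => twGen K k'
  gen_nonneg := fun _ k' => by
    cases k' with
    | zero => exact (mul_pos (by norm_num) (coef_pos K)).le
    | succ n => exact le_rfl
  size_le := fun b k _ _ => by
    show twSize K k ≤ ∑ k' ∈ Icc 0 k, twLin K k' k
    rw [Finset.sum_eq_single_of_mem 0 (Finset.mem_Icc.mpr ⟨le_rfl, Nat.zero_le k⟩)]
    · exact le_rfl
    · intro k' _ hk'
      cases k' with
      | zero => exact absurd rfl hk'
      | succ n => rfl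

/-- TOY TOWER [decided toy]: one run parameter, the toy booking and trajectory at every cutoff. -/
def twTower : DressedTower Unit where
  B := fun _ K => twBooking K
  K_eq := fun _ _ => rfl
  T := fun _ K => twTrajectory K

end Summit.QuantumFields.BalabanUV.T4Continuum.NE1p.DressedTwoSidedRegularityWitness

end
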